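/-
b2b-lace packet, CARVER gen 27 (unit `b2b-lace-carver-g27`).  HOME/LEMMAS node D10H-2k-T (child of D10H-2k, p214981): the TRUE SRW
tables UNDER THE PER-KEY ALTERNATIVE of `NobleH1StepD80`, the table-level Step 1 from `SlotAlt`, the corollaries with only the six cells left,
the per-entry reduction "a literal dominates an alternative entry", and the comparison "the alternative never costs".  Additive: no existing
module is modified; d-generic; no numeral; no named fact; no dimension sentence.
-/
import Literature.Probability.FitznerVanDerHofstad2017.NobleF3TrueTables
import Literature.Probability.FitznerVanDerHofstad2017.NobleH1StepD80
import HarnessLib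

/-!
# Literature.Probability.FitznerVanDerHofstad2017.NobleF3TrueTablesAlt — the true tables of (S2b)-IMPR under the per-key Step-1 alternative

CITATION HEADER (PLACEMENT v2). Part of a certified REPRODUCTION of R. Fitzner, R. van der Hofstad, *Generalized approach to the
non-backtracking lace expansion*, Probab. Theory Related Fields 169 (2017) 1041–1119 [NoBLE17], §3.3.3 (3.29)–(3.30) and §3.3.4
(3.35)–(3.38) (the SRW tables `IM`, `T`, `U`, `K`) and §3.3.5 (3.58)–(3.87) (the bound on `f₃`), with the companion *Mean-field behavior
for nearest-neighbor percolation in `d > 10`*, Electron. J. Probab. 22 (2017) no. 43 [FvdH17], (2.21)–(2.23) and §2.5: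

> [NoBLE17] p. 1076, (3.61)–(3.62): the slot bounds of Step 1, "`∫ … ≤ 𝒥_{n,l}(x)`" and "`… ≤ I_{n+1,l}(x)/(d α_F) …`", and (3.64) the
> table `IM`; p. 1076, (3.71): the bound on `∫ Ĥ₁ Ĝⁿ D̂^l D̂^{(x)}` "in terms of the SRW-integrals `I_{n,l}`, `𝒥_{n,l}`, `T_{n,l}`";
> p. 1079, (3.87): "`f₃(z) ≤ max_{{n,l,S} ∈ 𝒮} sup_{x ∈ S} (Σ_{i=1}^5 BoundH[i](n,l,x)) / c_{n,l,S}`".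

Every `[cite:]` tag below is a LOCATOR for comparison, not an appeal to authority: all statements are proved here from tree theorems.
DIVERGENCE D80 (packet): the printed slot bounds (3.61)/(3.62) hold only at `α_F = 1`; the tree's Step-1 leaf proves the UNCHANGED cell
`F3Bounds.boundH1` from corrected two-sided x-space slot bounds, either under print's table triple (H-IM)/(H-SC)/(H-low) (`NobleH1Step`) or —
`NobleH1StepD80` (p214981) — under the PER-KEY ALTERNATIVE `H1SlotD80.SlotAlt`: at each slot key EITHER print's triple OR the corrected
majorisation (H-IM-D80) `max (𝒥/α̲ + (ᾱ−1) I/(d α̲²)) ((ᾱ−1) S/(2d² α̲²)) ≤ IM`.  Nothing is decided here about numerals.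

## What this module does (HOME/LEMMAS D10H-2k-T)

`NobleF3TrueTables` (tail-g11) defines the true tables `srwTrue d α̲ ᾱ` — the pointwise-least table meeting print's triple — and carries
(S2b)-IMPR to "only the six cells at `srwTrue` remain".  This module is its twin under the alternative:

1. `H1SlotD80.env_mono`, `H1SlotD80.slotAlt_mono_right`, `H1SlotD80.slotAlt_of_env_majorants_le` — the corrected majorant
   `env` is monotone in `(𝒥, I, S)` and `SlotAlt` is upward closed in the table entry: certified MAJORANTS of `𝒥`, `I`, `S` and a literal
   dominating their `env` give `SlotAlt` at the key (the engines' entry point, one inequality per key).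
2. `F3Bounds.srwEnvIM d α̲ ᾱ m l v := env d (𝒥_{m+2,l} v) (I_{m+3,l} v) (S_{m+3,l} v) α̲ ᾱ 1 2` and the ALTERNATIVE TRUE TABLES
   `F3Bounds.srwTrueAlt d α̲ ᾱ`: `srwTrue` with the rows `m ≥ 0` of `IM` replaced by `min (srwTrue.IM m l v) (srwEnvIM d α̲ ᾱ m l v)` — the
   pointwise-least table meeting `SlotAlt` at every key (`slotAlt_srwTrueAlt`); rows `m ≤ −1`, `T`, `U`, `K` unchanged.
3. `NobleF3Witness.step1_of_alt_tables` — §1 of `NobleWeightedDiagramBoundTables` (lean2-g17) with (H-IM)/(H-SC)/(H-low) replaced by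
   `SlotAlt` at every key `m ≤ 1`; `nobleWeightedDiagramBoundAt_of_witness_tables_alt`, `…_of_simplifiedFormF3_tables_alt`,
   `nobleImprovementInputsAt_of_simplifiedFormF3_tables_alt` — its §2–§3 likewise (abstract table `τ`).
4. The corollaries AT `srwTrueAlt`: `nobleWeightedDiagramBoundAt_of_witness_srwTrueAlt`, `…_of_simplifiedFormF3_srwTrueAlt`,
   `nobleImprovementInputsAt_of_simplifiedFormF3_srwTrueAlt` — only `1 ≤ α̲_F`, well-formedness, (H-Γ) and the six CELL inequalities at
   `srwTrueAlt d α̲ ᾱ` remain displayed.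
5. Per-entry REDUCTION `srwTrueAlt_IM_natCast_le_iff`: a real `t` dominates the alternative entry `IM_alt[m,l,v]` (`m ≥ 0`) iff EITHER print's
   three inequalities `𝒥_{m+2,l}(v) ≤ t`, `I_{m+3,l}(v) ≤ dα̲·t`, `(ᾱ−1)S_{m+3,l}(v) ≤ 2d²·t` OR the single inequality `srwEnvIM d α̲ ᾱ m l v ≤ t` —
   the exact finite obligation, entry by entry, of a certified table under the alternative; `slotAlt_of_srwTrueAlt_IM_le` turns domination
   into `SlotAlt` at the key.
6. COMPARISON `srwTrueAlt_IM_le_srwTrue_IM`, `boundHD75_srwTrueAlt_le_srwTrue`: `srwTrueAlt ≤ srwTrue` entrywise, hence on well-formed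
   arguments every cell at `srwTrueAlt` is at most the cell at `srwTrue` (`F3Bounds.boundHD75_mono_at`): the alternative never costs, at any
   node, in any dimension.  Transport to a dominating table: `boundHD75_srwTrueAlt_le_of_dom_at`.

NOT here: any literal table, any certificate, any numeral (engine seats; HOME/LEMMAS D10H-2e).

Heartbeat census (packet filing rule): every declaration is a `rfl`, a `min`/`max` order step or a term-mode composition; nothing approaches
100 000; no option set.
-/

noncomputable section

open MeasureTheory Real
open Literature.Barriers.CriticalPhenomena
open Literature.Barriers.CriticalPhenomena.Slade2006Prop53 (P)
open Literature.Probability.LatticeModels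
open Literature.Probability.Percolation

namespace Literature.Probability.FitznerVanDerHofstad2017

variable {d : ℕ}

/-! ## 1. Monotonicity of the corrected majorant and upward closure of the alternative -/

namespace H1SlotD80

/-- The corrected majorant `env d 𝒥 I S α̲ ᾱ q₁ q₂ = max (𝒥/α̲^{q₁} + (ᾱ−1) I/(d α̲^{q₂})) ((ᾱ−1) S/(2d² α̲^{q₂}))` is monotone in
`(𝒥, I, S)` for `d > 0`, `α̲ > 0`, `ᾱ ≥ 1`: certified majorants of the three SRW quantities may replace them.
[cite: FitznerVanDerHofstad2016NoBLE, §3.3.5 (3.61)–(3.62), (3.64) p. 1076] -/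
theorem env_mono {dR a amax J I S J' I' S' : ℝ} (q₁ q₂ : ℕ) (hd : 0 < dR) (ha : 0 < a) (hamax : 1 ≤ amax)
    (hJ : J ≤ J') (hI : I ≤ I') (hS : S ≤ S') : env dR J I S a amax q₁ q₂ ≤ env dR J' I' S' a amax q₁ q₂ := by
  have hq1 : 0 < a ^ q₁ := pow_pos ha _
  have hq2 : 0 < dR * a ^ q₂ := mul_pos hd (pow_pos ha _)
  have hq3 : 0 < 2 * dR ^ 2 * a ^ q₂ := mul_pos (mul_pos two_pos (pow_pos hd 2)) (pow_pos ha _)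
  have h1 : 0 ≤ amax - 1 := by linarith
  unfold env
  exact max_le_max (add_le_add (div_le_div_of_nonneg_right hJ hq1.le)
      (div_le_div_of_nonneg_right (mul_le_mul_of_nonneg_left hI h1) hq2.le))
    (div_le_div_of_nonneg_right (mul_le_mul_of_nonneg_left hS h1) hq3.le)

/-- `SlotAlt` is upward closed in the table entry (`d ≥ 0`, `α̲ ≥ 0`): a larger entry still satisfies the alternative.
[cite: FitznerVanDerHofstad2016NoBLE, §3.3.5 (3.61)–(3.62), (3.64) p. 1076] -/
theorem slotAlt_mono_right {dR a amax J I S IM IM' : ℝ} (hd : 0 ≤ dR) (ha : 0 ≤ a) (h : SlotAlt dR a amax J I S IM)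
    (hle : IM ≤ IM') : SlotAlt dR a amax J I S IM' := by
  rcases h with ⟨hJ, hSC, hlow⟩ | h
  · refine Or.inl ⟨hJ.trans hle, hSC.trans ?_, hlow.trans ?_⟩
    · exact mul_le_mul_of_nonneg_left hle (mul_nonneg hd ha)
    · exact mul_le_mul_of_nonneg_left hle (mul_nonneg two_pos.le (pow_nonneg hd 2))
  · exact Or.inr (h.trans hle)

/-- **The engines' entry point, one inequality per key.**  If `𝒥 ≤ 𝒥'`, `I ≤ I'`, `S ≤ S'` (certified majorants) and the literal `IM` dominates
`env d 𝒥' I' S' α̲ ᾱ 1 2`, then `SlotAlt d α̲ ᾱ 𝒥 I S IM` (right disjunct). [cite: FitznerVanDerHofstad2016NoBLE, §3.3.5 (3.61)–(3.62), (3.64) p. 1076] -/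
theorem slotAlt_of_env_majorants_le {dR a amax J I S J' I' S' IM : ℝ} (hd : 0 < dR) (ha : 0 < a) (hamax : 1 ≤ amax)
    (hJ : J ≤ J') (hI : I ≤ I') (hS : S ≤ S') (h : env dR J' I' S' a amax 1 2 ≤ IM) : SlotAlt dR a amax J I S IM :=
  slotAlt_of_env_le ((env_mono 1 2 hd ha hamax hJ hI hS).trans h)

end H1SlotD80

namespace F3Bounds

/-! ## 2. The alternative true tables -/

/-- The corrected-majorisation entry (H-IM-D80) at the TRUE SRW values: `env d (𝒥_{m+2,l} v) (I_{m+3,l} v) (S_{m+3,l} v) α̲ ᾱ 1 2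
= max (𝒥_{m+2,l}(v)/α̲ + (ᾱ−1) I_{m+3,l}(v)/(d α̲²)) ((ᾱ−1) S_{m+3,l}(v)/(2d² α̲²))`.
[cite: FitznerVanDerHofstad2016NoBLE, §3.3.5 (3.61)–(3.62), (3.64) p. 1076] -/
def srwEnvIM (d : ℕ) (afmin afmax : ℝ) (m l : ℕ) (v : Fin d → ℤ) : ℝ :=
  H1SlotD80.env d (srwJ d (m + 2) l v) (srwI d (m + 3) l v) (srwIShift2 d (m + 3) l v) afmin afmax 1 2

/-- The `IM` column of the alternative true tables: for `m ≥ 0` the minimum of print's least entry `srwTrueIM` and the corrected entry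
`srwEnvIM`; for `m ≤ −1` print's least entry (the `m = −1` slot is not affected by D80's alternative).
[cite: FitznerVanDerHofstad2016NoBLE, §3.3.3 (3.29)–(3.30) p. 1070; §3.3.5 (3.61)–(3.64) pp. 1074–1076] -/
def srwTrueAltIM (d : ℕ) (afmin afmax : ℝ) : ℤ → ℕ → (Fin d → ℤ) → ℝ
  | Int.ofNat m, l, v => min (srwTrueIM d afmin afmax (Int.ofNat m) l v) (srwEnvIM d afmin afmax m l v)
  | Int.negSucc k, l, v => srwTrueIM d afmin afmax (Int.negSucc k) l v

/-- **The ALTERNATIVE TRUE SRW tables** `srwTrueAlt d α̲ ᾱ`: `IM := srwTrueAltIM`, and `T := srwTS d α̲`, `U := srwU d`, `K := srwK d` as in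
`srwTrue` — the pointwise-least table meeting `H1SlotD80.SlotAlt` at every key `m ≥ 0` and print's `m = −1` conditions.
[cite: FitznerVanDerHofstad2016NoBLE, §3.3.4 (3.35)–(3.38) p. 1071; §3.3.5 (3.61)–(3.64) pp. 1074–1076] -/
def srwTrueAlt (d : ℕ) (afmin afmax : ℝ) : Tables (Fin d → ℤ) where
  IM := srwTrueAltIM d afmin afmax
  T := fun m l v => srwTS d afmin m l v
  U := fun m l v => srwU d m l v
  K := fun m l v => srwK d m l v

variable {afmin afmax : ℝ}

/-- The `IM` column at `m ≥ 0`: the minimum of print's least entry and the corrected entry. [cite: FitznerVanDerHofstad2016NoBLE, §3.3.5 (3.64) p. 1076] -/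
@[simp] theorem srwTrueAlt_IM_natCast (m l : ℕ) (v : Fin d → ℤ) :
    (srwTrueAlt d afmin afmax).IM (m : ℤ) l v = min ((srwTrue d afmin afmax).IM (m : ℤ) l v) (srwEnvIM d afmin afmax m l v) := rfl

/-- The `IM` column at `m = −1` is print's. [cite: FitznerVanDerHofstad2016NoBLE, §3.3.5 (3.63)–(3.64) p. 1076] -/
@[simp] theorem srwTrueAlt_IM_negOne (l : ℕ) (v : Fin d → ℤ) :
    (srwTrueAlt d afmin afmax).IM (-1) l v = (srwTrue d afmin afmax).IM (-1) l v := rfl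

/-- Every `m ≤ −1` row equals print's `m = −1` row. [cite: FitznerVanDerHofstad2016NoBLE, §3.3.5 (3.63)–(3.64) p. 1076] -/
theorem srwTrueAlt_IM_negSucc (k l : ℕ) (v : Fin d → ℤ) :
    (srwTrueAlt d afmin afmax).IM (Int.negSucc k) l v = (srwTrue d afmin afmax).IM (-1) l v := rfl

/-- The `T` column. [cite: FitznerVanDerHofstad2016NoBLE, §3.3.4 (3.37) p. 1071] -/
@[simp] theorem srwTrueAlt_T (m l : ℕ) (v : Fin d → ℤ) : (srwTrueAlt d afmin afmax).T m l v = srwTS d afmin m l v := rfl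

/-- The `U` column. [cite: FitznerVanDerHofstad2016NoBLE, §3.3.4 (3.38) p. 1071] -/
@[simp] theorem srwTrueAlt_U (m l : ℕ) (v : Fin d → ℤ) : (srwTrueAlt d afmin afmax).U m l v = srwU d m l v := rfl

/-- The `K` column. [cite: FitznerVanDerHofstad2016NoBLE, §3.3.4 (3.36) p. 1071] -/
@[simp] theorem srwTrueAlt_K (m l : ℕ) (v : Fin d → ℤ) : (srwTrueAlt d afmin afmax).K m l v = srwK d m l v := rfl

/-! ## 3. The alternative holds at the alternative true tables; comparison with print's true tables -/

/-- The alternative true entry is at most print's true entry, row by row. [cite: FitznerVanDerHofstad2016NoBLE, §3.3.5 (3.64) p. 1076] -/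
theorem srwTrueAlt_IM_le_srwTrue_IM (m : ℤ) (l : ℕ) (v : Fin d → ℤ) :
    (srwTrueAlt d afmin afmax).IM m l v ≤ (srwTrue d afmin afmax).IM m l v := by
  cases m with
  | ofNat m => exact min_le_left _ _
  | negSucc k => exact le_rfl

/-- The alternative true entry is at most the corrected entry (`m ≥ 0`). [cite: FitznerVanDerHofstad2016NoBLE, §3.3.5 (3.64) p. 1076] -/
theorem srwTrueAlt_IM_le_srwEnvIM (m l : ℕ) (v : Fin d → ℤ) :
    (srwTrueAlt d afmin afmax).IM m l v ≤ srwEnvIM d afmin afmax m l v := by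
  rw [srwTrueAlt_IM_natCast]; exact min_le_right _ _

/-- **`SlotAlt` holds at every key `m ≥ 0` of the alternative true tables** (`d ≥ 1`, `α̲ > 0`): the entry is one of the two least entries,
and each satisfies its disjunct. [cite: FitznerVanDerHofstad2016NoBLE, §3.3.5 (3.61)–(3.64) pp. 1074–1076] -/
theorem slotAlt_srwTrueAlt (hd : 1 ≤ d) (hα : 0 < afmin) (m l : ℕ) (v : Fin d → ℤ) :
    H1SlotD80.SlotAlt d afmin afmax (srwJ d (m + 2) l v) (srwI d (m + 3) l v) (srwIShift2 d (m + 3) l v)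
      ((srwTrueAlt d afmin afmax).IM m l v) := by
  rw [srwTrueAlt_IM_natCast]
  rcases min_choice ((srwTrue d afmin afmax).IM m l v) (srwEnvIM d afmin afmax m l v) with h | h <;> rw [h]
  · exact H1SlotD80.slotAlt_of_printed (srwJ_le_srwTrue_IM m l v) (srwI_le_mul_srwTrue_IM hd hα m l v)
      (mul_srwIShift2_le_mul_srwTrue_IM hd m l v)
  · exact H1SlotD80.slotAlt_of_env_le le_rfl

/-- (H-IM1) at the alternative true tables (the `m = −1` row is print's). [cite: FitznerVanDerHofstad2016NoBLE, §3.3.5 (3.63) p. 1076] -/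
theorem srwI_add_le_srwTrueAlt_IM_negOne (l : ℕ) (v : Fin d → ℤ) :
    srwI d 1 (l + 1) v + srwIShift2 d 2 l v / (2 * (d : ℝ) ^ 2 * afmin) ≤ (srwTrueAlt d afmin afmax).IM (-1) l v := by
  rw [srwTrueAlt_IM_negOne]; exact srwI_add_le_srwTrue_IM_negOne l v

/-- (H-low1) at the alternative true tables (`d ≥ 1`, `α̲ > 0`). [cite: FitznerVanDerHofstad2016NoBLE, §3.3.5 (3.63) p. 1076] -/
theorem srwI_two_le_mul_srwTrueAlt_IM_negOne (hd : 1 ≤ d) (hα : 0 < afmin) (l : ℕ) (v : Fin d → ℤ) :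
    srwI d 2 l v ≤ d * afmin * (srwTrueAlt d afmin afmax).IM (-1) l v := by
  rw [srwTrueAlt_IM_negOne]; exact srwI_two_le_mul_srwTrue_IM_negOne hd hα l v

/-- (H-T) at the alternative true tables (with equality). [cite: FitznerVanDerHofstad2016NoBLE, §3.3.4 (3.37) p. 1071] -/
theorem srwTS_le_srwTrueAlt_T (m l : ℕ) (v : Fin d → ℤ) : srwTS d afmin m l v ≤ (srwTrueAlt d afmin afmax).T m l v := le_rfl

/-! ## 4. Per-entry reduction: when does a literal dominate an alternative entry? -/

/-- **The characterisation.**  A real `t` dominates the alternative entry `IM_alt[m,l,v]` (`m ≥ 0`; `d ≥ 1`, `α̲ > 0`) iff EITHER print's three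
inequalities `𝒥_{m+2,l}(v) ≤ t`, `I_{m+3,l}(v) ≤ dα̲·t`, `(ᾱ−1)·S_{m+3,l}(v) ≤ 2d²·t` hold OR the corrected entry satisfies `srwEnvIM d α̲ ᾱ m l v ≤ t`.
[cite: FitznerVanDerHofstad2016NoBLE, §3.3.5 (3.61)–(3.64) pp. 1074–1076] -/
theorem srwTrueAlt_IM_natCast_le_iff (hd : 1 ≤ d) (hα : 0 < afmin) {m l : ℕ} {v : Fin d → ℤ} {t : ℝ} :
    (srwTrueAlt d afmin afmax).IM m l v ≤ t ↔
      (srwJ d (m + 2) l v ≤ t ∧ srwI d (m + 3) l v ≤ d * afmin * t ∧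
          (afmax - 1) * srwIShift2 d (m + 3) l v ≤ 2 * (d : ℝ) ^ 2 * t) ∨
        srwEnvIM d afmin afmax m l v ≤ t := by
  rw [srwTrueAlt_IM_natCast, min_le_iff, srwTrue_IM_natCast_le_iff hd hα]

/-- Sufficiency, print's branch. [cite: FitznerVanDerHofstad2016NoBLE, §3.3.5 (3.61)–(3.64) pp. 1074–1076] -/
theorem srwTrueAlt_IM_natCast_le_of_printed (hd : 1 ≤ d) (hα : 0 < afmin) {m l : ℕ} {v : Fin d → ℤ} {t : ℝ}
    (hJ : srwJ d (m + 2) l v ≤ t) (hI : srwI d (m + 3) l v ≤ d * afmin * t)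
    (hS : (afmax - 1) * srwIShift2 d (m + 3) l v ≤ 2 * (d : ℝ) ^ 2 * t) :
    (srwTrueAlt d afmin afmax).IM m l v ≤ t :=
  (srwTrueAlt_IM_le_srwTrue_IM (m : ℤ) l v).trans (srwTrue_IM_natCast_le hd hα hJ hI hS)

/-- Sufficiency, the corrected branch: `srwEnvIM d α̲ ᾱ m l v ≤ t` alone dominates the alternative entry.
[cite: FitznerVanDerHofstad2016NoBLE, §3.3.5 (3.61)–(3.64) pp. 1074–1076] -/
theorem srwTrueAlt_IM_natCast_le_of_env_le {m l : ℕ} {v : Fin d → ℤ} {t : ℝ} (h : srwEnvIM d afmin afmax m l v ≤ t) :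
    (srwTrueAlt d afmin afmax).IM m l v ≤ t :=
  (srwTrueAlt_IM_le_srwEnvIM m l v).trans h

/-- **Domination gives the alternative at the key.**  If a literal `t` dominates `IM_alt[m,l,v]` (`d ≥ 1`, `α̲ > 0`), then
`SlotAlt d α̲ ᾱ (𝒥_{m+2,l} v) (I_{m+3,l} v) (S_{m+3,l} v) t` — so a table dominating `srwTrueAlt` entrywise satisfies the hypothesis `hAlt` of
`NobleH1StepD80` / §5 below. [cite: FitznerVanDerHofstad2016NoBLE, §3.3.5 (3.61)–(3.64) pp. 1074–1076] -/
theorem slotAlt_of_srwTrueAlt_IM_le (hd : 1 ≤ d) (hα : 0 < afmin) {m l : ℕ} {v : Fin d → ℤ} {t : ℝ}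
    (h : (srwTrueAlt d afmin afmax).IM m l v ≤ t) :
    H1SlotD80.SlotAlt d afmin afmax (srwJ d (m + 2) l v) (srwI d (m + 3) l v) (srwIShift2 d (m + 3) l v) t :=
  H1SlotD80.slotAlt_mono_right (Nat.cast_nonneg d) hα.le (slotAlt_srwTrueAlt hd hα m l v) h

/-- Domination of the whole alternative `IM` column at a node reduces to the rows `m ≥ 0` and print's single row `m = −1`.
[cite: FitznerVanDerHofstad2016NoBLE, §3.3.5 (3.63)–(3.64) p. 1076] -/
theorem srwTrueAlt_IM_le_of_natCast_of_negOne {τ' : Tables (Fin d → ℤ)} {v : Fin d → ℤ}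
    (hnat : ∀ m l : ℕ, (srwTrueAlt d afmin afmax).IM m l v ≤ τ'.IM m l v)
    (hneg : ∀ (k l : ℕ), (srwTrue d afmin afmax).IM (-1) l v ≤ τ'.IM (Int.negSucc k) l v) :
    ∀ (m : ℤ) (l : ℕ), (srwTrueAlt d afmin afmax).IM m l v ≤ τ'.IM m l v := by
  intro m l
  cases m with
  | ofNat m => exact hnat m l
  | negSucc k => exact (srwTrueAlt_IM_negSucc k l v).le.trans (hneg k l)

/-- **The alternative never costs.**  On well-formed arguments every cell at the alternative true tables is at most the same cell at print's true
tables, at every node, in every dimension (`F3Bounds.boundHD75_mono_at` with `srwTrueAlt ≤ srwTrue` entrywise).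
[cite: FitznerVanDerHofstad2016NoBLE, §3.3.5 (3.87) p. 1079 with (3.64) p. 1076] -/
theorem boundHD75_srwTrueAlt_le_srwTrue {a : Args} (ha : a.WF) (n l : ℕ) (v : Fin d → ℤ) :
    boundHD75 (srwTrueAlt d afmin afmax) n l v a ≤ boundHD75 (srwTrue d afmin afmax) n l v a :=
  boundHD75_mono_at ha (fun m l => srwTrueAlt_IM_le_srwTrue_IM m l v) (fun _ _ => le_rfl) (fun _ _ => le_rfl)
    (fun _ _ => le_rfl) n l

end F3Bounds

open F3Bounds

/-! ## 5. Step 1 and the weighted-diagram bounds from an abstract table under the alternative -/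

/-- **[NoBLE17] §3.3.5 Step 1 ((3.60)–(3.71)) for every admissible witness, `n = 0, 1`, from a table under the PER-KEY ALTERNATIVE.**
For `d ≥ 9`, `1 ≤ α̲_F` and a table `τ` with `SlotAlt d α̲_F ᾱ_F (𝒥_{m+2,j} y) (I_{m+3,j} y) (S_{m+3,j} y) (IM[m,j,y])` at every key with `m ≤ 1`,
(H-IM1), (H-low1) and (H-T): every witness `NobleF3Witness d p B E r cΦ αΦ cF αF RΦ RF` satisfies
`|∫ Ĥ₁ Ĝⁿ D̂^l D̂^{(x)} dP/(2π)^d| ≤ F3Bounds.boundH1 τ n l x r` for `n ≤ 1` and all `l, x` — the binder `hStep1` of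
`nobleWeightedDiagramBoundAt_of_witness`, discharged WITHOUT the global (H-SC)/(H-low) (`NobleH1StepD80`).
[cite: FitznerVanDerHofstad2016NoBLE, §3.3.5 (3.58)–(3.71) pp. 1074–1076] [cite: FitznerVanDerHofstad2017, notebook General.nb In[2] BoundH[1]] -/
theorem NobleF3Witness.step1_of_alt_tables (hd : 9 ≤ d) {p : unitInterval} {B : NobleBeta} {E : NobleBetaF3} {r : F3Bounds.Args}
    (hα1 : 1 ≤ r.afmin) (τ : F3Bounds.Tables (Fin d → ℤ))
    (hAlt : ∀ (m j : ℕ) (y : Fin d → ℤ), m ≤ 1 → H1SlotD80.SlotAlt d r.afmin r.afmax (srwJ d (m + 2) j y)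
      (srwI d (m + 3) j y) (srwIShift2 d (m + 3) j y) (τ.IM m j y))
    (hIM1 : ∀ (j : ℕ) (y : Fin d → ℤ), srwI d 1 (j + 1) y + srwIShift2 d 2 j y / (2 * (d : ℝ) ^ 2 * r.afmin) ≤ τ.IM (-1) j y)
    (hLow1 : ∀ (j : ℕ) (y : Fin d → ℤ), srwI d 2 j y ≤ d * r.afmin * τ.IM (-1) j y)
    (hT : ∀ (m j : ℕ) (y : Fin d → ℤ), srwTS d r.afmin m j y ≤ τ.T m j y) :
    ∀ n ≤ 1, ∀ (l : ℕ) (x : Site d), ∀ ⦃cΦ αΦ cF αF : ℝ⦄ ⦃RΦ RF : Site d → ℝ⦄,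
      NobleF3Witness d p B E r cΦ αΦ cF αF RΦ RF →
      |(∫ k, (lapAtomsAt d cΦ αΦ cF αF RΦ RF k).H1 * (lapAtomsAt d cΦ αΦ cF αF RΦ RF k).G ^ n *
        Dhat d k ^ l * DhatSym d x k ∂P d) / (2 * π) ^ d| ≤ F3Bounds.boundH1 τ n l x r := by
  intro n hn l x cΦ αΦ cF αF RΦ RF w
  interval_cases n
  · exact abs_integral_H1_diagram_le_boundH1_zero_of_alt_tables (by omega) w.keyBounds w.fZero_lt_one hα1 τ
      (fun j y => by simpa using hAlt 0 j y (Nat.zero_le 1)) hIM1 hLow1 l x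
  · exact abs_integral_H1_diagram_le_boundH1_one_of_alt_tables (by omega) w.keyBounds w.fZero_lt_one hα1 τ hAlt hT l x

/-- **(S2b)-IMPR with Step 1 discharged under the alternative: the weighted-diagram bounds of `f₃` from an admissible witness and a table under
`SlotAlt`.**  For `d ≥ 9`, `p < p_c`, an admissible witness at well-formed `r` with (H-Γ) at `n = 0, 1` and `1 ≤ α̲_F`, a table `τ` with `K = srwK`,
`U = srwU`, (H-T), `SlotAlt` at every key `m ≤ 1`, (H-IM1), (H-low1), and the six cell inequalities `boundHD75 τ n_k l_k x r ≤ b_k` (`b_k ≥ 0`):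
`NobleWeightedDiagramBoundAt d p b`.
[cite: FitznerVanDerHofstad2016NoBLE, §3.3.5 (3.87) p. 1079 with (3.58)–(3.86) pp. 1074–1079] [cite: FitznerVanDerHofstad2017, (2.21)–(2.23), §2.5] -/
theorem nobleWeightedDiagramBoundAt_of_witness_tables_alt (hd : 9 ≤ d) {p : unitInterval}
    (hp : (p : ℝ) < criticalProb (zdGraph d) (0 : Site d)) {B : NobleBeta} {E : NobleBetaF3} {r : F3Bounds.Args}
    (hW : ∃ (cΦ αΦ cF αF : ℝ) (RΦ RF : Site d → ℝ), NobleF3Witness d p B E r cΦ αΦ cF αF RΦ RF)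
    (hr : r.WF) (hΓ : ∀ n ≤ 1, r.Gamma2dash ^ n * r.bRp ≤ r.bRpDelta) (hα1 : 1 ≤ r.afmin)
    (τ : F3Bounds.Tables (Fin d → ℤ)) (hK : ∀ m l x, τ.K m l x = srwK d m l x) (hU : ∀ m l x, τ.U m l x = srwU d m l x)
    (hT : ∀ (m j : ℕ) (y : Fin d → ℤ), srwTS d r.afmin m j y ≤ τ.T m j y)
    (hAlt : ∀ (m j : ℕ) (y : Fin d → ℤ), m ≤ 1 → H1SlotD80.SlotAlt d r.afmin r.afmax (srwJ d (m + 2) j y)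
      (srwI d (m + 3) j y) (srwIShift2 d (m + 3) j y) (τ.IM m j y))
    (hIM1 : ∀ (j : ℕ) (y : Fin d → ℤ), srwI d 1 (j + 1) y + srwIShift2 d 2 j y / (2 * (d : ℝ) ^ 2 * r.afmin) ≤ τ.IM (-1) j y)
    (hLow1 : ∀ (j : ℕ) (y : Fin d → ℤ), srwI d 2 j y ≤ d * r.afmin * τ.IM (-1) j y)
    {b : Fin 6 → ℝ} (hb : ∀ k, 0 ≤ b k)
    (h0 : ∀ x ∈ calX d, F3Bounds.boundHD75 τ 0 0 x r ≤ b 0) (h1 : ∀ x ∈ calX d, F3Bounds.boundHD75 τ 1 0 x r ≤ b 1)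
    (h2 : ∀ x ∈ calX d, F3Bounds.boundHD75 τ 1 1 x r ≤ b 2) (h3 : ∀ x ∈ calX d, F3Bounds.boundHD75 τ 1 2 x r ≤ b 3)
    (h4 : ∀ x ∈ calX d, F3Bounds.boundHD75 τ 1 3 x r ≤ b 4) (h5 : F3Bounds.boundHD75 τ 1 6 0 r ≤ b 5) :
    NobleWeightedDiagramBoundAt d p b :=
  nobleWeightedDiagramBoundAt_of_witness hd hp hW hr hΓ τ hK hU hT
    (NobleF3Witness.step1_of_alt_tables hd hα1 τ hAlt hIM1 hLow1 hT) hb h0 h1 h2 h3 h4 h5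

/-- **The same from the extended simplified form** `NobleSimplifiedFormF3At d p B E` below `p_c` under `f₂(p) ≤ Γ₂`, at the arguments
`r = NobleBetaF3.toArgs d B E Γ₂` (`1 ≤ α̲_F = B.αFlow`, `β̲_{ΔR,F} < α̲_F`), with a table under the alternative.
[cite: FitznerVanDerHofstad2016NoBLE, §3.3.5 (3.87) p. 1079; §3.3.4 pp. 1072–1074] [cite: FitznerVanDerHofstad2017, (2.21)–(2.23), §2.5] -/
theorem nobleWeightedDiagramBoundAt_of_simplifiedFormF3_tables_alt (hd : 9 ≤ d) {p : unitInterval}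
    (hp : (p : ℝ) < criticalProb (zdGraph d) (0 : Site d)) {B : NobleBeta} {E : NobleBetaF3} {Γ₂ : ℝ}
    (hF3 : NobleSimplifiedFormF3At d p B E) (hΓ2 : nobleF2 d p ≤ Γ₂) (hα1 : 1 ≤ B.αFlow) (hgap : B.βΔ < B.αFlow)
    (hr : (NobleBetaF3.toArgs d B E Γ₂).WF)
    (hΓ : ∀ n ≤ 1, (NobleBetaF3.toArgs d B E Γ₂).Gamma2dash ^ n * (NobleBetaF3.toArgs d B E Γ₂).bRp ≤
      (NobleBetaF3.toArgs d B E Γ₂).bRpDelta)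
    (τ : F3Bounds.Tables (Fin d → ℤ)) (hK : ∀ m l x, τ.K m l x = srwK d m l x) (hU : ∀ m l x, τ.U m l x = srwU d m l x)
    (hT : ∀ (m j : ℕ) (y : Fin d → ℤ), srwTS d B.αFlow m j y ≤ τ.T m j y)
    (hAlt : ∀ (m j : ℕ) (y : Fin d → ℤ), m ≤ 1 → H1SlotD80.SlotAlt d B.αFlow E.αFup (srwJ d (m + 2) j y)
      (srwI d (m + 3) j y) (srwIShift2 d (m + 3) j y) (τ.IM m j y))
    (hIM1 : ∀ (j : ℕ) (y : Fin d → ℤ), srwI d 1 (j + 1) y + srwIShift2 d 2 j y / (2 * (d : ℝ) ^ 2 * B.αFlow) ≤ τ.IM (-1) j y)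
    (hLow1 : ∀ (j : ℕ) (y : Fin d → ℤ), srwI d 2 j y ≤ d * B.αFlow * τ.IM (-1) j y)
    {b : Fin 6 → ℝ} (hb : ∀ k, 0 ≤ b k)
    (h0 : ∀ x ∈ calX d, F3Bounds.boundHD75 τ 0 0 x (NobleBetaF3.toArgs d B E Γ₂) ≤ b 0)
    (h1 : ∀ x ∈ calX d, F3Bounds.boundHD75 τ 1 0 x (NobleBetaF3.toArgs d B E Γ₂) ≤ b 1)
    (h2 : ∀ x ∈ calX d, F3Bounds.boundHD75 τ 1 1 x (NobleBetaF3.toArgs d B E Γ₂) ≤ b 2)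
    (h3 : ∀ x ∈ calX d, F3Bounds.boundHD75 τ 1 2 x (NobleBetaF3.toArgs d B E Γ₂) ≤ b 3)
    (h4 : ∀ x ∈ calX d, F3Bounds.boundHD75 τ 1 3 x (NobleBetaF3.toArgs d B E Γ₂) ≤ b 4)
    (h5 : F3Bounds.boundHD75 τ 1 6 0 (NobleBetaF3.toArgs d B E Γ₂) ≤ b 5) :
    NobleWeightedDiagramBoundAt d p b :=
  nobleWeightedDiagramBoundAt_of_witness_tables_alt hd hp
    (hF3.exists_witness (by omega) hp hΓ2 (lt_of_lt_of_le one_pos hα1) hgap) hr hΓ hα1 τ hK hU hT hAlt hIM1 hLow1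
    hb h0 h1 h2 h3 h4 h5

/-- **The improvement-step input of the numeric certificate from the extended simplified form, a table under the ALTERNATIVE and the six cells.**
For `d ≥ 9`: if at every `p ∈ (p_I, p_c)` with `f_i(p) ≤ Γ_i` the two-point function has the extended simplified form `NobleSimplifiedFormF3At d p B E`,
`1 ≤ α̲_F = B.αFlow`, `β_Δ < α̲_F`, `r = NobleBetaF3.toArgs d B E (Γ 1)` is well formed with (H-Γ) at `n = 0, 1`, the table `τ` has `K = srwK`,
`U = srwU`, (H-T), `SlotAlt` at every key `m ≤ 1`, (H-IM1), (H-low1), and the six cell inequalities hold with `b_k ≥ 0`, then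
`NobleImprovementInputsAt d cμ c Γ B b`.
[cite: FitznerVanDerHofstad2016NoBLE, §3.3.5 (3.87) p. 1079 with Steps 1–5; Assumption 2.7 and Prop. 4.5 (pp. 1059–1060, 1088)]
[cite: FitznerVanDerHofstad2017, Prop. 2.1–2.2, (2.21)–(2.23), §2.5] -/
theorem nobleImprovementInputsAt_of_simplifiedFormF3_tables_alt (hd : 9 ≤ d) {cμ : ℝ} {c : Fin 6 → ℝ} {Γ : Fin 3 → ℝ}
    {B : NobleBeta} {E : NobleBetaF3}
    (hF3 : ∀ p : unitInterval, p ∈ Set.Ioo (nbwThresholdI d) (criticalProbI d) →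
      (∀ i, nobleF d cμ c i p ≤ Γ i) → NobleSimplifiedFormF3At d p B E)
    (hα1 : 1 ≤ B.αFlow) (hgap : B.βΔ < B.αFlow) (hr : (NobleBetaF3.toArgs d B E (Γ 1)).WF)
    (hΓ : ∀ n ≤ 1, (NobleBetaF3.toArgs d B E (Γ 1)).Gamma2dash ^ n * (NobleBetaF3.toArgs d B E (Γ 1)).bRp ≤
      (NobleBetaF3.toArgs d B E (Γ 1)).bRpDelta)
    (τ : F3Bounds.Tables (Fin d → ℤ)) (hK : ∀ m l x, τ.K m l x = srwK d m l x) (hU : ∀ m l x, τ.U m l x = srwU d m l x)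
    (hT : ∀ (m j : ℕ) (y : Fin d → ℤ), srwTS d B.αFlow m j y ≤ τ.T m j y)
    (hAlt : ∀ (m j : ℕ) (y : Fin d → ℤ), m ≤ 1 → H1SlotD80.SlotAlt d B.αFlow E.αFup (srwJ d (m + 2) j y)
      (srwI d (m + 3) j y) (srwIShift2 d (m + 3) j y) (τ.IM m j y))
    (hIM1 : ∀ (j : ℕ) (y : Fin d → ℤ), srwI d 1 (j + 1) y + srwIShift2 d 2 j y / (2 * (d : ℝ) ^ 2 * B.αFlow) ≤ τ.IM (-1) j y)
    (hLow1 : ∀ (j : ℕ) (y : Fin d → ℤ), srwI d 2 j y ≤ d * B.αFlow * τ.IM (-1) j y)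
    {b : Fin 6 → ℝ} (hb : ∀ k, 0 ≤ b k)
    (h0 : ∀ x ∈ calX d, F3Bounds.boundHD75 τ 0 0 x (NobleBetaF3.toArgs d B E (Γ 1)) ≤ b 0)
    (h1 : ∀ x ∈ calX d, F3Bounds.boundHD75 τ 1 0 x (NobleBetaF3.toArgs d B E (Γ 1)) ≤ b 1)
    (h2 : ∀ x ∈ calX d, F3Bounds.boundHD75 τ 1 1 x (NobleBetaF3.toArgs d B E (Γ 1)) ≤ b 2)
    (h3 : ∀ x ∈ calX d, F3Bounds.boundHD75 τ 1 2 x (NobleBetaF3.toArgs d B E (Γ 1)) ≤ b 3)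
    (h4 : ∀ x ∈ calX d, F3Bounds.boundHD75 τ 1 3 x (NobleBetaF3.toArgs d B E (Γ 1)) ≤ b 4)
    (h5 : F3Bounds.boundHD75 τ 1 6 0 (NobleBetaF3.toArgs d B E (Γ 1)) ≤ b 5) :
    NobleImprovementInputsAt d cμ c Γ B b :=
  nobleImprovementInputsAt_of_simplifiedFormF3 hd hF3 (lt_of_lt_of_le one_pos hα1) hgap hr hΓ τ hK hU hT
    (fun _ _ _ => NobleF3Witness.step1_of_alt_tables hd hα1 τ hAlt hIM1 hLow1 hT) hb h0 h1 h2 h3 h4 h5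

/-! ## 6. The weighted-diagram bounds of `f₃` at the alternative true tables: only the cells remain -/

/-- **(S2b)-IMPR at the ALTERNATIVE TRUE tables, from an admissible witness.**  For `d ≥ 9`, `p < p_c`, an admissible witness of the extended
simplified form at well-formed `r` with (H-Γ) at `n = 0, 1` and `1 ≤ α̲_F`: the six cell inequalities `boundHD75 (srwTrueAlt d α̲_F ᾱ_F) n_k l_k x r ≤ b_k`
(`b_k ≥ 0`) give `NobleWeightedDiagramBoundAt d p b` — every table-side condition discharged at `srwTrueAlt` by §3.
[cite: FitznerVanDerHofstad2016NoBLE, §3.3.5 (3.87) p. 1079 with (3.58)–(3.86) pp. 1074–1079] [cite: FitznerVanDerHofstad2017, (2.21)–(2.23), §2.5] -/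
theorem nobleWeightedDiagramBoundAt_of_witness_srwTrueAlt (hd : 9 ≤ d) {p : unitInterval}
    (hp : (p : ℝ) < criticalProb (zdGraph d) (0 : Site d)) {B : NobleBeta} {E : NobleBetaF3} {r : F3Bounds.Args}
    (hW : ∃ (cΦ αΦ cF αF : ℝ) (RΦ RF : Site d → ℝ), NobleF3Witness d p B E r cΦ αΦ cF αF RΦ RF)
    (hr : r.WF) (hΓ : ∀ n ≤ 1, r.Gamma2dash ^ n * r.bRp ≤ r.bRpDelta) (hα1 : 1 ≤ r.afmin)
    {b : Fin 6 → ℝ} (hb : ∀ k, 0 ≤ b k)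
    (h0 : ∀ x ∈ calX d, boundHD75 (srwTrueAlt d r.afmin r.afmax) 0 0 x r ≤ b 0)
    (h1 : ∀ x ∈ calX d, boundHD75 (srwTrueAlt d r.afmin r.afmax) 1 0 x r ≤ b 1)
    (h2 : ∀ x ∈ calX d, boundHD75 (srwTrueAlt d r.afmin r.afmax) 1 1 x r ≤ b 2)
    (h3 : ∀ x ∈ calX d, boundHD75 (srwTrueAlt d r.afmin r.afmax) 1 2 x r ≤ b 3)
    (h4 : ∀ x ∈ calX d, boundHD75 (srwTrueAlt d r.afmin r.afmax) 1 3 x r ≤ b 4)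
    (h5 : boundHD75 (srwTrueAlt d r.afmin r.afmax) 1 6 0 r ≤ b 5) :
    NobleWeightedDiagramBoundAt d p b :=
  have hd1 : 1 ≤ d := by omega
  have hα : 0 < r.afmin := lt_of_lt_of_le one_pos hα1
  nobleWeightedDiagramBoundAt_of_witness_tables_alt hd hp hW hr hΓ hα1 (srwTrueAlt d r.afmin r.afmax)
    (fun _ _ _ => rfl) (fun _ _ _ => rfl) (fun m j y => srwTS_le_srwTrueAlt_T m j y)
    (fun m j y _ => slotAlt_srwTrueAlt hd1 hα m j y) (fun j y => srwI_add_le_srwTrueAlt_IM_negOne j y)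
    (fun j y => srwI_two_le_mul_srwTrueAlt_IM_negOne hd1 hα j y) hb h0 h1 h2 h3 h4 h5

/-- **(S2b)-IMPR at the ALTERNATIVE TRUE tables, from the extended simplified form** `NobleSimplifiedFormF3At d p B E` below `p_c` under
`f₂(p) ≤ Γ₂`, at `r = NobleBetaF3.toArgs d B E Γ₂` (`1 ≤ α̲_F = B.αFlow`, `β_Δ < α̲_F`): only the six cells at `srwTrueAlt d B.αFlow E.αFup` remain.
[cite: FitznerVanDerHofstad2016NoBLE, §3.3.5 (3.87) p. 1079; §3.3.4 pp. 1072–1074] [cite: FitznerVanDerHofstad2017, (2.21)–(2.23), §2.5] -/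
theorem nobleWeightedDiagramBoundAt_of_simplifiedFormF3_srwTrueAlt (hd : 9 ≤ d) {p : unitInterval}
    (hp : (p : ℝ) < criticalProb (zdGraph d) (0 : Site d)) {B : NobleBeta} {E : NobleBetaF3} {Γ₂ : ℝ}
    (hF3 : NobleSimplifiedFormF3At d p B E) (hΓ2 : nobleF2 d p ≤ Γ₂) (hα1 : 1 ≤ B.αFlow) (hgap : B.βΔ < B.αFlow)
    (hr : (NobleBetaF3.toArgs d B E Γ₂).WF)
    (hΓ : ∀ n ≤ 1, (NobleBetaF3.toArgs d B E Γ₂).Gamma2dash ^ n * (NobleBetaF3.toArgs d B E Γ₂).bRp ≤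
      (NobleBetaF3.toArgs d B E Γ₂).bRpDelta)
    {b : Fin 6 → ℝ} (hb : ∀ k, 0 ≤ b k)
    (h0 : ∀ x ∈ calX d, boundHD75 (srwTrueAlt d B.αFlow E.αFup) 0 0 x (NobleBetaF3.toArgs d B E Γ₂) ≤ b 0)
    (h1 : ∀ x ∈ calX d, boundHD75 (srwTrueAlt d B.αFlow E.αFup) 1 0 x (NobleBetaF3.toArgs d B E Γ₂) ≤ b 1)
    (h2 : ∀ x ∈ calX d, boundHD75 (srwTrueAlt d B.αFlow E.αFup) 1 1 x (NobleBetaF3.toArgs d B E Γ₂) ≤ b 2)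
    (h3 : ∀ x ∈ calX d, boundHD75 (srwTrueAlt d B.αFlow E.αFup) 1 2 x (NobleBetaF3.toArgs d B E Γ₂) ≤ b 3)
    (h4 : ∀ x ∈ calX d, boundHD75 (srwTrueAlt d B.αFlow E.αFup) 1 3 x (NobleBetaF3.toArgs d B E Γ₂) ≤ b 4)
    (h5 : boundHD75 (srwTrueAlt d B.αFlow E.αFup) 1 6 0 (NobleBetaF3.toArgs d B E Γ₂) ≤ b 5) :
    NobleWeightedDiagramBoundAt d p b :=
  have hd1 : 1 ≤ d := by omega
  have hα : 0 < B.αFlow := lt_of_lt_of_le one_pos hα1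
  nobleWeightedDiagramBoundAt_of_simplifiedFormF3_tables_alt hd hp hF3 hΓ2 hα1 hgap hr hΓ (srwTrueAlt d B.αFlow E.αFup)
    (fun _ _ _ => rfl) (fun _ _ _ => rfl) (fun m j y => srwTS_le_srwTrueAlt_T m j y)
    (fun m j y _ => slotAlt_srwTrueAlt hd1 hα m j y) (fun j y => srwI_add_le_srwTrueAlt_IM_negOne j y)
    (fun j y => srwI_two_le_mul_srwTrueAlt_IM_negOne hd1 hα j y) hb h0 h1 h2 h3 h4 h5

/-- **The improvement-step input of the numeric certificate at the ALTERNATIVE TRUE tables** — no table-side condition of §3.3.5 left displayed.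
For `d ≥ 9`: if at every `p ∈ (p_I, p_c)` with `f_i(p) ≤ Γ_i` the two-point function has the extended simplified form `NobleSimplifiedFormF3At d p B E`,
`1 ≤ α̲_F`, `β_Δ < α̲_F`, `r = NobleBetaF3.toArgs d B E (Γ 1)` is well formed with (H-Γ) at `n = 0, 1`, and the six cell inequalities hold at
`srwTrueAlt d B.αFlow E.αFup` with `b_k ≥ 0`, then `NobleImprovementInputsAt d cμ c Γ B b`.
[cite: FitznerVanDerHofstad2016NoBLE, §3.3.5 (3.87) p. 1079 with Steps 1–5; Assumption 2.7 and Prop. 4.5 (pp. 1059–1060, 1088)]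
[cite: FitznerVanDerHofstad2017, Prop. 2.1–2.2, (2.21)–(2.23), §2.5] -/
theorem nobleImprovementInputsAt_of_simplifiedFormF3_srwTrueAlt (hd : 9 ≤ d) {cμ : ℝ} {c : Fin 6 → ℝ} {Γ : Fin 3 → ℝ}
    {B : NobleBeta} {E : NobleBetaF3}
    (hF3 : ∀ p : unitInterval, p ∈ Set.Ioo (nbwThresholdI d) (criticalProbI d) →
      (∀ i, nobleF d cμ c i p ≤ Γ i) → NobleSimplifiedFormF3At d p B E)
    (hα1 : 1 ≤ B.αFlow) (hgap : B.βΔ < B.αFlow) (hr : (NobleBetaF3.toArgs d B E (Γ 1)).WF)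
    (hΓ : ∀ n ≤ 1, (NobleBetaF3.toArgs d B E (Γ 1)).Gamma2dash ^ n * (NobleBetaF3.toArgs d B E (Γ 1)).bRp ≤
      (NobleBetaF3.toArgs d B E (Γ 1)).bRpDelta)
    {b : Fin 6 → ℝ} (hb : ∀ k, 0 ≤ b k)
    (h0 : ∀ x ∈ calX d, boundHD75 (srwTrueAlt d B.αFlow E.αFup) 0 0 x (NobleBetaF3.toArgs d B E (Γ 1)) ≤ b 0)
    (h1 : ∀ x ∈ calX d, boundHD75 (srwTrueAlt d B.αFlow E.αFup) 1 0 x (NobleBetaF3.toArgs d B E (Γ 1)) ≤ b 1)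
    (h2 : ∀ x ∈ calX d, boundHD75 (srwTrueAlt d B.αFlow E.αFup) 1 1 x (NobleBetaF3.toArgs d B E (Γ 1)) ≤ b 2)
    (h3 : ∀ x ∈ calX d, boundHD75 (srwTrueAlt d B.αFlow E.αFup) 1 2 x (NobleBetaF3.toArgs d B E (Γ 1)) ≤ b 3)
    (h4 : ∀ x ∈ calX d, boundHD75 (srwTrueAlt d B.αFlow E.αFup) 1 3 x (NobleBetaF3.toArgs d B E (Γ 1)) ≤ b 4)
    (h5 : boundHD75 (srwTrueAlt d B.αFlow E.αFup) 1 6 0 (NobleBetaF3.toArgs d B E (Γ 1)) ≤ b 5) :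
    NobleImprovementInputsAt d cμ c Γ B b :=
  have hd1 : 1 ≤ d := by omega
  have hα : 0 < B.αFlow := lt_of_lt_of_le one_pos hα1
  nobleImprovementInputsAt_of_simplifiedFormF3_tables_alt hd hF3 hα1 hgap hr hΓ (srwTrueAlt d B.αFlow E.αFup)
    (fun _ _ _ => rfl) (fun _ _ _ => rfl) (fun m j y => srwTS_le_srwTrueAlt_T m j y)
    (fun m j y _ => slotAlt_srwTrueAlt hd1 hα m j y) (fun j y => srwI_add_le_srwTrueAlt_IM_negOne j y)
    (fun j y => srwI_two_le_mul_srwTrueAlt_IM_negOne hd1 hα j y) hb h0 h1 h2 h3 h4 h5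

/-! ## 7. Transport of the cells to a dominating table at the node (the certificate-side entry point) -/

/-- **Cells at a table dominating the alternative true tables.**  If a table `τ'` dominates `srwTrueAlt d α̲ ᾱ` AT THE NODE `v` — rows `m ≥ 0`
of `IM` via print's three inequalities OR the single corrected inequality per entry (`srwTrueAlt_IM_natCast_le_iff`), rows `m ≤ −1` via print's
two `m = −1` inequalities, and `TS ≤ τ'.T`, `U ≤ τ'.U`, `K ≤ τ'.K` entrywise at `v` — then on well-formed arguments
`boundHD75 (srwTrueAlt d α̲ ᾱ) n l v a ≤ boundHD75 τ' n l v a` (`F3Bounds.boundHD75_mono_at`).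
[cite: FitznerVanDerHofstad2016NoBLE, §3.3.5 (3.87) p. 1079 with (3.64) p. 1076] -/
theorem boundHD75_srwTrueAlt_le_of_dom_at {afmin afmax : ℝ} {τ' : Tables (Fin d → ℤ)} {v : Fin d → ℤ} {a : F3Bounds.Args} (ha : a.WF)
    (hnat : ∀ m l : ℕ, (srwTrueAlt d afmin afmax).IM m l v ≤ τ'.IM m l v)
    (hneg : ∀ (k l : ℕ), (srwTrue d afmin afmax).IM (-1) l v ≤ τ'.IM (Int.negSucc k) l v)
    (hT : ∀ m l, srwTS d afmin m l v ≤ τ'.T m l v) (hU : ∀ m l, srwU d m l v ≤ τ'.U m l v)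
    (hK : ∀ m l, srwK d m l v ≤ τ'.K m l v) (n l : ℕ) :
    boundHD75 (srwTrueAlt d afmin afmax) n l v a ≤ boundHD75 τ' n l v a :=
  boundHD75_mono_at ha (srwTrueAlt_IM_le_of_natCast_of_negOne hnat hneg) hT hU hK n l

end Literature.Probability.FitznerVanDerHofstad2017

end
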